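import Summits.HubbardSuperconductivity.HubbardSuperconductivity.Theorems.WeakCouplingBCSKlPinchOrder
import Summits.HubbardSuperconductivity.HubbardSuperconductivity.Theorems.WeakCouplingBCSDefsKlCertTPrime

/-!
# The monotone-cone (double Abel) ORDER of the transported `B1g` Kohn–Luttinger kernels — a value-free, eigenvector-free
# route to «the `d`-wave coupling is monotone toward the van Hove level» (KL-MARGIN-SCAN HQ1 (ii)/(iii); `t' = 0` proved layer,
# `t' ≠ 0` typed targets)

Reader seat hubbard-klscan-idea-2 (lens control), round 7, crux idea «cone-order-dwave-monotone», bearing on the certificate half of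
`WcbcsKohnLuttingerB1g` (stmt-HubbardSuperconductivity-0158).  A Kohn–Luttinger `O(U²)` channel statement is not ODLRO; nothing here
proves superconductivity in the Hubbard model; nothing is ASSERTED at `t' ≠ 0`, about `K₃`, the onset window or `U₀`.  This file holds
NO numerical record.  It fixes the SHAPE of a new order certificate and proves that the shape decides the order.

THE LEVER.  Fold the `χ`-twisted kernel to the fundamental arc of the Fermi curve (polar chart, `θ = 0` the antinode, `θ = π/4` the
node; `pairingForm_eq_polar`, `inChannel_radialTransport`), so that every level `μ` acts on ONE state space; write `A_μ := -K̂ᴮ¹ᵍ_μ`.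
Along `μ ↑ 0⁻` the kernels are NOT ordered entrywise (idea-4 r2 census F3; round-7 floats: 5–47 % negative mass, node columns) but
they ARE ordered in the MONOTONE-CONE order: every antinode-anchored rectangle mass of `A_{μa} - (1+g)·A_{μb}` is `≥ 0`
(`μb < μa`, some `g > 0`; zero violations in every tested family, see the card).  By a DOUBLE ABEL SUMMATION (§1, PROVED) this is
exactly positivity of the form on pairs of non-increasing non-negative arc functions; and the `d`-wave ground state IS such a function
(antinode-heavy, node-vanishing).  Hence, in the `inf` language of `channelInf` (§2, PROVED): cone domination + «the cone holds
near-minimisers at the anchor `μb`» ⇒ `(1+g)·|λ_B1g(μb)| ≤ |λ_B1g(μa)|` =: `ConeGain μa μb g` — no eigenvector VALUE, no eigen-solve,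
no Temple gap.  §3 books the consequences in tree currency: monotone `d`-wave strength, and — with the cell's Ritz floor at `μb`
and a rival drift bound — the rival-margin ORDER (`KlPinchOrder.PinchOrderCert` is implied: `pinch_of_coneGain`), the grid form
`KlPinchOrder.GridOrderT0` and a pairwise-to-continuum lift.  §4 types the `t' ≠ 0` targets (Γ side / M side of the van Hove level,
and the `δ = 1/8` iso-density segments of idea-3 r7 / idea-4 r7), NOT asserted.
References: [HornJohnson2013] §8.1–8.3 (order-preserving maps, Collatz–Wielandt), [ReedSimonIV1978] XIII.12 (positivity and ground
states), [RaghuKivelsonScalapino2010] §III (the float picture), Shaked–Shanthikumar, Stochastic Orders (2007) §3–4 (orthant /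
supermodular orders: the rectangle test is the bivariate «concordance» order).  Float evidence: evidence on stmt-0158 (round 7).
-/

noncomputable section

-- the tree's namespace convention repeats the summit name by design (D-0017)
set_option linter.dupNamespace false

open Real Set Finset
open Literature.MathematicalPhysics.QuantumLattice
open Summit.HubbardSuperconductivity.HubbardSuperconductivity.Theorems
open Summit.HubbardSuperconductivity.HubbardSuperconductivity.Theorems.KlNotB1g
open Summit.HubbardSuperconductivity.HubbardSuperconductivity.Theorems.KlPinchOrder

namespace Summit.HubbardSuperconductivity.HubbardSuperconductivity.Theorems.KlConeOrder

/-! ## §1  The double Abel summation (matrix core, PROVED)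

`Fin n` indexes the cells of the folded arc from the antinode (`0`) to the node (`n-1`).  The monotone cone is parametrised by its
non-negative INCREMENTS `c`: `coneVec c i = Σ_{I ≥ i} c_I` is non-increasing and non-negative; the antinode-anchored rectangle sums
`rectSum D I J = Σ_{i ≤ I, j ≤ J} D_ij` are the engine's check.  `quad_coneVec` is the bilinear Abel identity. -/

variable {n : ℕ}

/-- A vector of the monotone cone, given by non-negative increments: `x_i = Σ_{I ≥ i} c_I`. -/
def coneVec (c : Fin n → ℝ) (i : Fin n) : ℝ := ∑ I, if i ≤ I then c I else 0

/-- Antinode-anchored rectangle sum `Σ_{i ≤ I} Σ_{j ≤ J} D i j`. -/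
def rectSum (D : Fin n → Fin n → ℝ) (I J : Fin n) : ℝ := ∑ i, ∑ j, if i ≤ I then (if j ≤ J then D i j else 0) else 0

/-- Cone vectors with non-negative increments are non-negative. -/
theorem coneVec_nonneg {c : Fin n → ℝ} (hc : ∀ I, 0 ≤ c I) (i : Fin n) : 0 ≤ coneVec c i :=
  Finset.sum_nonneg fun I _ => by split_ifs <;> simp [hc I]

/-- Cone vectors with non-negative increments are non-increasing from the antinode to the node. -/
theorem coneVec_antitone {c : Fin n → ℝ} (hc : ∀ I, 0 ≤ c I) : Antitone (coneVec c) := by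
  intro i i' hii'
  refine Finset.sum_le_sum fun I _ => ?_
  by_cases h1 : i' ≤ I
  · have h2 : i ≤ I := le_trans hii' h1
    simp [h1, h2]
  · by_cases h2 : i ≤ I
    · simp [h1, h2, hc I]
    · simp [h1, h2]

/-- **The bilinear double Abel identity (PROVED):** `Σᵢⱼ x_i D_ij y_j = Σ_{IJ} c_I c'_J · rectSum D I J` for cone vectors
`x = coneVec c`, `y = coneVec c'`. -/
theorem quad_coneVec (c c' : Fin n → ℝ) (D : Fin n → Fin n → ℝ) :
    ∑ i, ∑ j, coneVec c i * D i j * coneVec c' j = ∑ I, ∑ J, c I * c' J * rectSum D I J := by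
  -- both sides are the fourfold sum of `T i j I J`
  set T : Fin n → Fin n → Fin n → Fin n → ℝ :=
    fun i j I J => if i ≤ I then (if j ≤ J then c I * D i j * c' J else 0) else 0 with hT
  -- (`simp` distributes the right factor first, so the outer bound variable is the `c'`-index `J`)
  have h1 : ∀ i j, coneVec c i * D i j * coneVec c' j = ∑ J, ∑ I, T i j I J := by
    intro i j
    simp only [coneVec, Finset.sum_mul, Finset.mul_sum, hT]
    refine Finset.sum_congr rfl fun J _ => Finset.sum_congr rfl fun I _ => ?_
    split_ifs <;> ring
  have h2 : ∀ I J, c I * c' J * rectSum D I J = ∑ i, ∑ j, T i j I J := by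
    intro I J
    simp only [rectSum, Finset.mul_sum, hT]
    refine Finset.sum_congr rfl fun i _ => Finset.sum_congr rfl fun j _ => ?_
    split_ifs <;> ring
  simp_rw [h1, h2]
  calc ∑ i, ∑ j, ∑ J, ∑ I, T i j I J = ∑ i, ∑ J, ∑ j, ∑ I, T i j I J :=
        Finset.sum_congr rfl fun i _ => Finset.sum_comm
    _ = ∑ J, ∑ i, ∑ j, ∑ I, T i j I J := Finset.sum_comm
    _ = ∑ J, ∑ i, ∑ I, ∑ j, T i j I J :=
        Finset.sum_congr rfl fun J _ => Finset.sum_congr rfl fun i _ => Finset.sum_comm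
    _ = ∑ J, ∑ I, ∑ i, ∑ j, T i j I J := Finset.sum_congr rfl fun J _ => Finset.sum_comm
    _ = ∑ I, ∑ J, ∑ i, ∑ j, T i j I J := Finset.sum_comm

/-- **Cone positivity from rectangle positivity (PROVED):** if every antinode-anchored rectangle sum of `D` is `≥ 0` then the
bilinear form of `D` is `≥ 0` on every pair of cone vectors.  This is the finite model of hypothesis (PS) of the card. -/
theorem quad_coneVec_nonneg {c c' : Fin n → ℝ} {D : Fin n → Fin n → ℝ} (hD : ∀ I J, 0 ≤ rectSum D I J)
    (hc : ∀ I, 0 ≤ c I) (hc' : ∀ J, 0 ≤ c' J) : 0 ≤ ∑ i, ∑ j, coneVec c i * D i j * coneVec c' j := by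
  rw [quad_coneVec]
  exact Finset.sum_nonneg fun I _ => Finset.sum_nonneg fun J _ => mul_nonneg (mul_nonneg (hc I) (hc' J)) (hD I J)

/-- **Cone domination with ratio, model form (PROVED):** if the rectangle sums of `Aa - (1+g)·Ab` are all `≥ 0` then on every cone
vector `x`, `(1+g)·xᵀ Ab x ≤ xᵀ Aa x` — the matrix shadow of `ConeGain`. -/
theorem quad_coneVec_ratio {c : Fin n → ℝ} {Aa Ab : Fin n → Fin n → ℝ} {g : ℝ}
    (hD : ∀ I J, 0 ≤ rectSum (fun i j => Aa i j - (1 + g) * Ab i j) I J) (hc : ∀ I, 0 ≤ c I) :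
    (1 + g) * ∑ i, ∑ j, coneVec c i * Ab i j * coneVec c j ≤ ∑ i, ∑ j, coneVec c i * Aa i j * coneVec c j := by
  have h := quad_coneVec_nonneg (D := fun i j => Aa i j - (1 + g) * Ab i j) hD hc hc
  have hsplit : ∑ i, ∑ j, coneVec c i * (Aa i j - (1 + g) * Ab i j) * coneVec c j =
      ∑ i, ∑ j, coneVec c i * Aa i j * coneVec c j - (1 + g) * ∑ i, ∑ j, coneVec c i * Ab i j * coneVec c j := by
    simp only [Finset.mul_sum, ← Finset.sum_sub_distrib]
    refine Finset.sum_congr rfl fun i _ => Finset.sum_congr rfl fun j _ => ?_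
    ring
  rw [hsplit] at h
  linarith

/-- A weighted cone (`x_i = w_i · coneVec c i`, e.g. `w = cos 2θ`, the first `d`-wave harmonic: the «`d`-weighted» cone of the card's
M-side tables) reduces to the plain one for the reweighted array `w_i D_ij w_j` (PROVED). -/
theorem quad_wconeVec_nonneg {c c' w : Fin n → ℝ} {D : Fin n → Fin n → ℝ}
    (hD : ∀ I J, 0 ≤ rectSum (fun i j => w i * D i j * w j) I J) (hc : ∀ I, 0 ≤ c I) (hc' : ∀ J, 0 ≤ c' J) :
    0 ≤ ∑ i, ∑ j, (w i * coneVec c i) * D i j * (w j * coneVec c' j) := by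
  have h := quad_coneVec_nonneg (D := fun i j => w i * D i j * w j) hD hc hc'
  have : ∑ i, ∑ j, (w i * coneVec c i) * D i j * (w j * coneVec c' j) =
      ∑ i, ∑ j, coneVec c i * (w i * D i j * w j) * coneVec c' j :=
    Finset.sum_congr rfl fun i _ => Finset.sum_congr rfl fun j _ => by ring
  rw [this]; exact h

/-! ## §2  The `inf` comparison (abstract, PROVED)

`channelInf` is an `sInf` of the pulled-back form over the channel states.  Cone domination of the forms on a sub-cone `C` that holds
NEAR-MINIMISERS of the anchor form gives the ratio comparison of the two infima — no attainment, no eigenvector value. -/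

/-- **Ratio comparison of infima from cone domination (PROVED).** -/
theorem sInf_le_mul_sInf_of_cone {ι : Type*} {S C : Set ι} {qa qb : ι → ℝ} {g : ℝ} (hCS : C ⊆ S)
    (hbd : BddBelow (qa '' S)) (hg : 0 ≤ 1 + g) (hdom : ∀ ψ ∈ C, qa ψ ≤ (1 + g) * qb ψ)
    (happ : ∀ ε > 0, ∃ ψ ∈ C, qb ψ ≤ sInf (qb '' S) + ε) : sInf (qa '' S) ≤ (1 + g) * sInf (qb '' S) := by
  refine le_of_forall_pos_le_add fun ε hε => ?_
  by_cases hg0 : 1 + g = 0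
  · obtain ⟨ψ, hψC, -⟩ := happ 1 one_pos
    have h1 : sInf (qa '' S) ≤ qa ψ := csInf_le hbd ⟨ψ, hCS hψC, rfl⟩
    have h2 := hdom ψ hψC
    rw [hg0] at h2 ⊢; linarith
  · have hgpos : 0 < 1 + g := lt_of_le_of_ne hg (Ne.symm hg0)
    obtain ⟨ψ, hψC, hψ⟩ := happ (ε / (1 + g)) (div_pos hε hgpos)
    have h1 : sInf (qa '' S) ≤ qa ψ := csInf_le hbd ⟨ψ, hCS hψC, rfl⟩
    have h2 := hdom ψ hψC
    have h3 : (1 + g) * qb ψ ≤ (1 + g) * sInf (qb '' S) + ε := by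
      have := mul_le_mul_of_nonneg_left hψ hg
      rwa [mul_add, mul_div_cancel₀ _ hg0] at this
    linarith

/-! ## §3  Tree currency at `t' = 0` (PROVED): cone gain ⇒ monotone `d`-wave strength, rival-margin order, grid and continuum lifts -/

/-- The `d`-wave (B1g) coupling strength `|λ_B1g(μ)| = -channelInf ε₀ μ 1 B1g` of the nearest-neighbour band. -/
def b1gStrength (μ : ℝ) : ℝ := -channelInf (squareDispersion 1 0) μ 1 D4Irrep.B1g

/-- **Cone gain leaf** for the pair `(μa, μb)` (`μb < μa < 0`: `μa` is closer to half filling): `(1+g)·|λ_B1g(μb)| ≤ |λ_B1g(μa)|`.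
The record behind it is the rectangle-sum table of `A_{μa} - (1+g) A_{μb}` on the common arc (§1) plus the anchor-shape clause (§2). -/
def ConeGain (μa μb g : ℝ) : Prop := (1 + g) * b1gStrength μb ≤ b1gStrength μa

/-- A two-level CONE CHART (hypothesis-carrying; realising it is the engine's job, nothing is claimed to exist): a common state index
`ι`, the `B1g` states `S`, a sub-cone `C ⊆ S`, the pulled-back forms `q μ`, exactness of the pull-back at both levels, and the
anchor-shape clause «`C` holds near-minimisers of `q μb`» ((SH) of the card, in `inf` language). -/
structure B1gConeChart (μa μb : ℝ) where
  /-- common state index (e.g. arc functions after `√w`-folding) -/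
  ι : Type
  /-- admissible normalised `B1g` states, pulled back -/
  S : Set ι
  /-- the cone (e.g. non-increasing non-negative arc profiles, or their `cos 2θ`-weighted version) -/
  C : Set ι
  /-- the pulled-back pairing forms, `q μ ψ` -/
  q : ℝ → ι → ℝ
  cone_sub : C ⊆ S
  bddBelow : BddBelow (q μa '' S)
  exact_a : channelInf (squareDispersion 1 0) μa 1 D4Irrep.B1g = sInf (q μa '' S)
  exact_b : channelInf (squareDispersion 1 0) μb 1 D4Irrep.B1g = sInf (q μb '' S)
  /-- (SH): the cone contains near-minimisers of the anchor form -/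
  approx : ∀ ε > 0, ∃ ψ ∈ C, q μb ψ ≤ sInf (q μb '' S) + ε

/-- **Soundness of the cone gain leaf (PROVED):** a cone chart plus cone domination with ratio `g` ((PS) of the card) give `ConeGain`. -/
theorem coneGain_of_chart {μa μb g : ℝ} (L : B1gConeChart μa μb) (hg : 0 ≤ 1 + g)
    (hPS : ∀ ψ ∈ L.C, L.q μa ψ ≤ (1 + g) * L.q μb ψ) : ConeGain μa μb g := by
  have h := sInf_le_mul_sInf_of_cone L.cone_sub L.bddBelow hg hPS L.approx
  unfold ConeGain b1gStrength
  rw [L.exact_a, L.exact_b]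
  linarith

/-- Cone gain with `g ≥ 0` at a level of non-negative strength orders the strengths (PROVED). -/
theorem b1gStrength_le_of_coneGain {μa μb g : ℝ} (h : ConeGain μa μb g) (hg : 0 ≤ g) (hb : 0 ≤ b1gStrength μb) :
    b1gStrength μb ≤ b1gStrength μa := by
  unfold ConeGain at h; nlinarith

/-- **Cone gain ⇒ the pinch certificate of `KlPinchOrder` (PROVED):** with the cell's Rayleigh floor `R ≤ |λ_B1g(μb)|` at the ANCHOR
(`R` need not be signed) and a rival drift bound `ω < g·R` with `g ≥ 0`, the pair carries a `PinchOrderCert` (floor `(1+g)·|λ_B1g(μb)|` at `μa`, the trivial ceiling at `μb`). -/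
theorem pinch_of_coneGain {μa μb g R ω : ℝ} (h : ConeGain μa μb g) (hF : RayleighFloor μb R) (hg : 0 ≤ g)
    (hD : RivalDrift μa μb ω) (hω : ω < g * R) : PinchOrderCert μa μb := by
  unfold ConeGain b1gStrength at h
  unfold RayleighFloor at hF
  refine ⟨(1 + g) * -channelInf (squareDispersion 1 0) μb 1 D4Irrep.B1g, -channelInf (squareDispersion 1 0) μb 1 D4Irrep.B1g, ω,
    h, le_rfl, hD, ?_⟩
  nlinarith [mul_le_mul_of_nonneg_left hF hg]

/-- **Rival-margin order from a cone gain (PROVED):** `m(μb) < m(μa)`. -/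
theorem rivalMargin_lt_of_coneGain {μa μb g R ω : ℝ} (h : ConeGain μa μb g) (hF : RayleighFloor μb R)
    (hg : 0 ≤ g) (hD : RivalDrift μa μb ω) (hω : ω < g * R) : rivalMargin μb < rivalMargin μa :=
  rivalMargin_lt_of_pinch (pinch_of_coneGain h hF hg hD hω)

/-- **HQ1 (ii) on the `t' = 0` grid from six cone certificates (PROVED):** reuses `KlPinchOrder.GridOrderT0` verbatim. -/
theorem gridOrderT0_of_coneGain
    (h : ∀ i : Fin 6, ∃ g R ω : ℝ, ConeGain (muOfDoping (gridδ i.castSucc)) (muOfDoping (gridδ i.succ)) g ∧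
      RayleighFloor (muOfDoping (gridδ i.succ)) R ∧ 0 ≤ g ∧
      RivalDrift (muOfDoping (gridδ i.castSucc)) (muOfDoping (gridδ i.succ)) ω ∧ ω < g * R) : GridOrderT0 := by
  refine gridOrderT0_of_pinch fun i => ?_
  obtain ⟨g, R, ω, hc, hF, hg, hD, hω⟩ := h i
  exact pinch_of_coneGain hc hF hg hD hω

/-- The CONTINUUM target (NOT asserted): the `d`-wave strength is non-decreasing in `μ` on a set `s` (toward half filling). -/
def B1gStrengthMonoOn (s : Set ℝ) : Prop := MonotoneOn b1gStrength s

/-- The scan window in `μ`: `[μ(0.35), μ(0.05)]` (`muOfDoping` is antitone in `δ`, so this is the doping window `[0.05, 0.35]`). -/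
def scanWindowMu : Set ℝ := Icc (muOfDoping (7 / 20)) (muOfDoping (1 / 20))

/-- **HQ1 (ii), `B1g` half, continuum form at `t' = 0` (target, NOT asserted).** -/
def B1gStrengthMonoOnWindow : Prop := B1gStrengthMonoOn scanWindowMu

/-- Generic lift (PROVED): pairwise ratio gains with `g ≥ 0` on a set where `f ≥ 0` make `f` monotone there. -/
theorem monotoneOn_of_pairGain {f : ℝ → ℝ} {s : Set ℝ} (hpos : ∀ x ∈ s, 0 ≤ f x)
    (h : ∀ x ∈ s, ∀ y ∈ s, x ≤ y → ∃ g : ℝ, 0 ≤ g ∧ (1 + g) * f x ≤ f y) : MonotoneOn f s := by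
  intro x hx y hy hxy
  obtain ⟨g, hg, hgain⟩ := h x hx y hy hxy
  nlinarith [hpos x hx]

/-- **Pairwise cone gains on a set ⇒ the continuum target on that set (PROVED).**  (The engine proves the pairwise family at once from
the DIFFERENTIAL rectangle condition `∂_μ ∫∫_{[0,Θ]×[0,Θ']} (-k̂_μ) ≥ 0` — rectangle masses are `C¹` in `μ` although `∂_μ k̂_μ` is not
Hilbert–Schmidt across the folded `2k_F` caustics: the derivative never meets the kernel pointwise.) -/
theorem b1gStrengthMonoOn_of_coneGain {s : Set ℝ} (hpos : ∀ μ ∈ s, 0 ≤ b1gStrength μ)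
    (h : ∀ μb ∈ s, ∀ μa ∈ s, μb ≤ μa → ∃ g : ℝ, 0 ≤ g ∧ ConeGain μa μb g) : B1gStrengthMonoOn s :=
  monotoneOn_of_pairGain hpos h

/-- **Continuum rival-margin order from pairwise cone certificates (PROVED):** the margin is strictly increasing in `μ` on `s`. -/
theorem rivalMargin_strictMonoOn_of_coneGain {s : Set ℝ}
    (h : ∀ μb ∈ s, ∀ μa ∈ s, μb < μa → ∃ g R ω : ℝ, ConeGain μa μb g ∧ RayleighFloor μb R ∧ 0 ≤ g ∧
      RivalDrift μa μb ω ∧ ω < g * R) : StrictMonoOn rivalMargin s := by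
  intro μb hb μa ha hlt
  obtain ⟨g, R, ω, hc, hF, hg, hD, hω⟩ := h μb hb μa ha hlt
  exact rivalMargin_lt_of_coneGain hc hF hg hD hω

/-! ## §4  `t' ≠ 0` targets (typed, NOT asserted): toward the van Hove level from both sides, and the `δ = 1/8` segments

`ε_{t'} = squareDispersion 1 tp`, van Hove level `4tp`, VH exclusion strip `|μ - 4tp| < 1/40` (INBOX l.284 convention).  Floats (card):
Γ side (`μ < 4tp`): plain monotone cone clean; M side (`μ > 4tp`): the `cos 2θ`-weighted cone clean; near-VH cells excluded. -/

/-- `|λ_B1g(μ)|` for the `t`–`t'` band. -/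
def b1gStrengthTP (tp μ : ℝ) : ℝ := -channelInf (squareDispersion 1 tp) μ 1 D4Irrep.B1g

/-- Γ-side target: the `d`-wave strength is non-decreasing in `μ` on `[a, 4tp - 1/40]` (toward the van Hove level from below). -/
def B1gTowardVH_Gamma (tp a : ℝ) : Prop := MonotoneOn (b1gStrengthTP tp) (Icc a (4 * tp - 1 / 40))

/-- M-side target: the `d`-wave strength is non-increasing in `μ` on `[4tp + 1/40, b]` (decreasing away from the van Hove level). -/
def B1gTowardVH_M (tp b : ℝ) : Prop := AntitoneOn (b1gStrengthTP tp) (Icc (4 * tp + 1 / 40) b)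

/-- `δ = 1/8` line, Γ segment of idea-3 r7 (`tp ∈ [-3/25, 0]`): strength grows as `tp` DEcreases toward the pole `t* ≈ -0.15`. -/
def B1gLine18_Gamma : Prop := AntitoneOn (fun tp => b1gStrengthTP tp (klMuOfDopingTP tp (1 / 8))) (Icc (-3 / 25) 0)

/-- `δ = 1/8` line, M segment (`tp ∈ [-3/10, -9/50]`): strength grows as `tp` INcreases toward the pole. -/
def B1gLine18_M : Prop := MonotoneOn (fun tp => b1gStrengthTP tp (klMuOfDopingTP tp (1 / 8))) (Icc (-3 / 10) (-9 / 50))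

/-- The generic lift serves every `t' ≠ 0` target as well (PROVED instance: the M segment of the `1/8` line from pairwise gains). -/
theorem b1gLine18_M_of_pairGain
    (hpos : ∀ tp ∈ Icc (-3 / 10 : ℝ) (-9 / 50), 0 ≤ b1gStrengthTP tp (klMuOfDopingTP tp (1 / 8)))
    (h : ∀ x ∈ Icc (-3 / 10 : ℝ) (-9 / 50), ∀ y ∈ Icc (-3 / 10 : ℝ) (-9 / 50), x ≤ y → ∃ g : ℝ, 0 ≤ g ∧
      (1 + g) * b1gStrengthTP x (klMuOfDopingTP x (1 / 8)) ≤ b1gStrengthTP y (klMuOfDopingTP y (1 / 8))) : B1gLine18_M :=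
  monotoneOn_of_pairGain hpos h

end Summit.HubbardSuperconductivity.HubbardSuperconductivity.Theorems.KlConeOrder

end
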